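import Summits.QuantumFields.YangMills.Theorems.UnitScaleTiltProp7NearFieldGreenGradientSum
import Summits.QuantumFields.YangMills.Theorems.UnitScaleTiltProp7TorusGreen2GradientBound
import Summits.QuantumFields.YangMills.Theorems.UnitScaleTiltProp7TorusGreen2HessianDecay
import Summits.QuantumFields.YangMills.Theorems.UnitScaleTiltProp7TorusGreenSizeDecay
import HarnessLib

/-!
# Route `UnitScaleTilt`, crux K1 «MinimiserStabilityRegPr» (stmt-QuantumFields-19200), route-R E′ path (α′), (E1-b) siblings (hK₀)∕(hK₂): THE NEAR-FIELD BALL SUM OF THE SIZE OF THE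
# TORUS GREEN FUNCTION IN `d = 3` — `Σ_{z : ∀μ |z̃_μ| ≤ R} |G̃_L(z)| ≤ C₀ + 54·C·R²` for `2R < L` (the `Σ_{r≤ℓ} r²·r⁻¹ ≍ ℓ²` count of ★routeR-w3 g5's (E1) LOCATE §3: (hK₀)'s near field
# through ✓p662031's `hLf`, and (hK₂)'s `Σ_{r≲ℓ}|G₁|`), over the POINTWISE size row `|G̃_L(z)|·√(Σz̃²) ≤ C` (`z ≠ 0`; px4 g2's (G₁-SIZE-3) ✓ `…Prop7TorusGreenSizeDecay.torusGreen_mul_dist_le`, displayed as `hC` in §3–§5 and discharged in §6) and the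
# all-`z` bound `|G̃_L(z)| ≤ C₀` proved here; plus the `r^{−(d−2)}` shell-sum letter and the B5 `Δ⁻¹` reading (centred ball)

Cell `ym3-torus`, D-0154 (3c) twin-width seat `ym-ust-19200-w8` (gen 7); offer «(G₁-SIZE-BALL)» 21:00Z on ★p1 g15's NAMER round 3 (E1-b).  Sibling of px7's ✓p662443
`…NearFieldGreenGradientSum.sum_ball_abs_torusGreen_grad_le` (`Σ_{ball}|∇G̃| ≤ C(R+1)`, shell decay `r⁻²`) with shell decay `r⁻¹` instead (hence `R²`): same window `ℤ³ → (ℤ/Lℤ)³` below half the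
period (✓ `valMinAbs_intCast_of_two_mul_abs_lt`, ✓ `sq_le_sum_sq_of_mem_shell`), same sub-sum device, and the `(d−2)`-exponent sibling of ✓ `…NearFieldShellSum.sum_box_le_of_shell_decay`.  THEOREMS
ONLY (0 `def`, 0 `sorry`); `--supports stmt-QuantumFields-19200`, count-neutral.  YM₃ on T³ is a ladder rung (R3), not the Clay problem; nothing here claims the stub, the crux, d = 4 or the gap.

WHAT IS PROVED (ns `…Theorems.Prop7NearFieldGreenSizeSum`).
* §1 ★ `sum_box_le_of_shell_decay_two` (any `d ≥ 2`) — shells bounded by `A∕r^{d−2}` ⇒ `Σ_{Q_R(z)}|k| ≤ |k z| + 2d·3^{d−1}·A·R²`.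
* §2 ★ `abs_torusGreen_le` (`d = 3`) — `∃ C₀ ≥ 0, ∀ L z, |G̃_L(z)| ≤ C₀` (ALL `z`, incl. the pole; heat part `|∏q^L_s| ≤ K³(1∨s)^{−3∕2} ≤ 2√2K³((s+1)√(s+1))⁻¹`, ✓ px13
  `integral_inv_mul_sqrt_le`; zero mode `L²·L⁻³ ≤ 1`; tail `≤ C₁³∕8` by ✓ `eight_div_sq_le_dispersion`).
* §3 `abs_torusGreen_window_le_of_mem_shell` — under `hC`, on the sup-shell `r` (`1 ≤ r`, `2r < L`): `|G̃_L(πy)| ≤ C∕r^{3−2}`.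
* §4 ★★ `sum_box_abs_torusGreen_le_of_size`, ★★ `sum_ball_abs_torusGreen_le_of_size (hC) : Σ_{z : ∀μ |z̃_μ| ≤ R} |G̃_L(z)| ≤ C₀ + 54·C·R²` (`2R < L`; explicit constants).
* §5 ★★★ `sum_ball_abs_torusGreen_le` (`≤ C·(R+1)²`, `hC` discharged by px4's ✓ `…Prop7TorusGreenSizeDecay.torusGreen_mul_dist_le`) and ★★ `sum_ball_norm_LapSinv_le` (B5's letters,
  centred at `b`: `Σ_{z : ∀μ |(b−z)̃_μ| ≤ R} ‖Δ⁻¹(b,z)‖ ≤ C·(R+1)²`, via ✓p659572 and `z ↦ b − z`).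
HONEST SCOPE.  Helper lattice lemmas.  No Yang–Mills statement is touched.
References: Lawler–Limic, *Random Walk: A Modern Introduction* (2010) Thm 4.3.1 [LawlerLimic2010]; Giaquinta (1983) Ch. III §1 [Giaquinta1984]; Bałaban, CMP 95 (1984) Sect. C [Balaban1984PropagatorsI].
-/

set_option autoImplicit false

noncomputable section

open MeasureTheory Set Finset ZMod intervalIntegral
open scoped Real BigOperators

namespace Summit.QuantumFields.YangMills.Theorems.Prop7NearFieldGreenSizeSum

open Literature.Probability.LatticeModels
open Literature.MathematicalPhysics.QuantumFieldTheory.Balaban1983to89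
open B4Eq19LatticeOperators B5LaplaceInverse
open Prop7TorusGreenGradientBricks Prop7TorusGreenDictionary Prop7NearFieldShellSum Prop7NearFieldGreenGradientSum
open Prop7TorusGreen2GradientBound Prop7TorusGreen2HessianDecay Prop7TorusGreenSizeDecay

variable {d L : ℕ}

/-! ## §1 The shell-sum letter with decay `r^{−(d−2)}` -/

/-- ★ **ONE SHELL, decay `r^{−(d−2)}`**: if `|k(y)| ≤ A·r^{−(d−2)}` on `Q_r(z) ∖ Q_{r−1}(z)` (`r ≥ 1`, `A ≥ 0`, `d ≥ 2`), then `Σ_{Q_r∖Q_{r−1}}|k| ≤ 2d·3^{d−1}·A·r`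
(`#shell ≤ 2d·3^{d−1}r^{d−1}`, ✓ `card_shell_le`). [folklore] -/
theorem sum_shell_le_two (hd : 2 ≤ d) (z : Zd d) {r : ℤ} (hr : 1 ≤ r) (k : Zd d → ℝ) {A : ℝ} (hA : 0 ≤ A)
    (hk : ∀ y ∈ (box z r) \ (box z (r - 1)), |k y| ≤ A / (r : ℝ) ^ (d - 2)) :
    ∑ y ∈ (box z r) \ (box z (r - 1)), |k y| ≤ 2 * d * 3 ^ (d - 1) * A * r := by
  have hr0 : (0 : ℝ) < r := by exact_mod_cast (show (0 : ℤ) < r by linarith)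
  have hrp : (0 : ℝ) < (r : ℝ) ^ (d - 2) := pow_pos hr0 _
  have hpow : (r : ℝ) ^ (d - 1) = (r : ℝ) ^ (d - 2) * r := by
    rw [show d - 1 = (d - 2) + 1 by omega, pow_succ]
  calc ∑ y ∈ (box z r) \ (box z (r - 1)), |k y| ≤ ∑ _y ∈ (box z r) \ (box z (r - 1)), A / (r : ℝ) ^ (d - 2) := Finset.sum_le_sum hk
    _ = (((box z r) \ (box z (r - 1))).card : ℝ) * (A / (r : ℝ) ^ (d - 2)) := by rw [Finset.sum_const, nsmul_eq_mul]
    _ ≤ 2 * d * 3 ^ (d - 1) * (r : ℝ) ^ (d - 1) * (A / (r : ℝ) ^ (d - 2)) :=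
        mul_le_mul_of_nonneg_right (card_shell_le (by omega) z hr) (by positivity)
    _ = 2 * d * 3 ^ (d - 1) * A * r := by rw [hpow]; field_simp

/-- ★ **THE SHELL SUM WITH DECAY `r^{−(d−2)}`**: if `|k(y)| ≤ A·r^{−(d−2)}` on every shell `Q_r(z) ∖ Q_{r−1}(z)`, `1 ≤ r ≤ R` (`d ≥ 2`), then
`Σ_{y ∈ Q_R(z)}|k(y)| ≤ |k(z)| + 2d·3^{d−1}·A·R²` — quadratic in the radius: in d = 3 this is the `Σ_{r≤ℓ} r²·r⁻¹ ≍ ℓ²` count of (hK₀)∕(hK₂). [folklore] -/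
theorem sum_box_le_of_shell_decay_two (hd : 2 ≤ d) (z : Zd d) (k : Zd d → ℝ) {A : ℝ} (hA : 0 ≤ A) :
    ∀ R : ℕ, (∀ r : ℤ, 1 ≤ r → r ≤ R → ∀ y ∈ (box z r) \ (box z (r - 1)), |k y| ≤ A / (r : ℝ) ^ (d - 2)) →
      ∑ y ∈ box z R, |k y| ≤ |k z| + 2 * d * 3 ^ (d - 1) * A * (R : ℝ) ^ 2
  | 0 => by
      intro _
      have h0 : box z ((0 : ℕ) : ℤ) = {z} := by
        ext y
        simp only [Nat.cast_zero, B4Eq19LatticeOperators.mem_box, abs_nonpos_iff, sub_eq_zero, Finset.mem_singleton]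
        exact ⟨fun h => funext h, fun h i => by rw [h]⟩
      rw [h0, Finset.sum_singleton]
      simp
  | (R + 1) => by
      intro hk
      have ih := sum_box_le_of_shell_decay_two hd z k hA R (fun r h1 h2 => hk r h1 (by push_cast; linarith))
      have hsub : box z (R : ℤ) ⊆ box z ((R + 1 : ℕ) : ℤ) := box_mono z (by push_cast; linarith)
      have hR1 : (1 : ℤ) ≤ ((R + 1 : ℕ) : ℤ) := by push_cast; linarith
      have hshell := sum_shell_le_two hd z hR1 k hA (by
        intro y hy
        have e : ((R + 1 : ℕ) : ℤ) - 1 = (R : ℤ) := by push_cast; ring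
        have hy' : y ∈ (box z ((R + 1 : ℕ) : ℤ)) \ (box z (((R + 1 : ℕ) : ℤ) - 1)) := by rw [e]; rw [e] at hy; exact hy
        have := hk ((R + 1 : ℕ) : ℤ) hR1 le_rfl y hy'
        exact_mod_cast this)
      have e : ((R + 1 : ℕ) : ℤ) - 1 = (R : ℤ) := by push_cast; ring
      rw [e] at hshell
      rw [← Finset.sum_sdiff hsub]
      have hc0 : (0 : ℝ) ≤ 2 * d * 3 ^ (d - 1) * A := by positivity
      have hR0 : (0 : ℝ) ≤ R := Nat.cast_nonneg R
      calc ∑ y ∈ (box z ((R + 1 : ℕ) : ℤ)) \ (box z (R : ℤ)), |k y| + ∑ y ∈ box z (R : ℤ), |k y|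
          ≤ 2 * d * 3 ^ (d - 1) * A * (((R + 1 : ℕ) : ℤ) : ℝ) + (|k z| + 2 * d * 3 ^ (d - 1) * A * (R : ℝ) ^ 2) :=
            add_le_add hshell ih
        _ = |k z| + 2 * d * 3 ^ (d - 1) * A * ((R : ℝ) ^ 2 + ((R : ℝ) + 1)) := by push_cast; ring
        _ ≤ |k z| + 2 * d * 3 ^ (d - 1) * A * ((R + 1 : ℕ) : ℝ) ^ 2 := by
            push_cast
            have : (R : ℝ) ^ 2 + ((R : ℝ) + 1) ≤ ((R : ℝ) + 1) ^ 2 := by nlinarith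
            exact add_le_add le_rfl (mul_le_mul_of_nonneg_left this hc0)

/-! ## §2 ★ The torus Green function is bounded, uniformly in the period (all `z`, `d = 3`) -/

/-- ★ **`|G̃_L(z)| ≤ C₀` for ALL `z ∈ (ℤ/Lℤ)³`, uniformly in `L ≥ 1`** (`C₀ = 4√2K³ + 1 + C₁³∕8`, `C₁ = Σ_{n∈ℤ}2^{−|n|}`): by ✓ `torusGreen_eq_integral_add_tail z (L²)` — the product
kernel is `≤ ∏_μ K(1∨s)^{−1∕2} = K³(1∨s)^{−3∕2} ≤ 2√2K³((s+1)√(s+1))⁻¹` (three ✓ `abs_torusHeatKernel_le`, Gaussian weights dropped, `2(1∨s) ≥ s+1`), time integral `≤ 2` (✓ `integral_inv_mul_sqrt_le`,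
`c = 1`); the zero mode costs `∫₀^{L²}L⁻³ = L⁻¹ ≤ 1`; the Fourier tail `L⁻³Σ_{k≠0}e^{−L²ε_k}∕ε_k ≤ L⁻³·(L²∕8)·C₁³ ≤ C₁³∕8` (✓ `eight_div_sq_le_dispersion`, ✓ `exp_neg_sq_mul_dispersion_le`,
✓ `exp_neg_eight_mul_sq_le`, ✓ `sum_half_pow_valMinAbs_le`).  The lattice form of «`|x|⁻¹` is locally integrable»: the centre term of the near-field ball sum. [folklore] -/
theorem abs_torusGreen_le : ∃ C₀ : ℝ, 0 ≤ C₀ ∧ ∀ (L : ℕ) [NeZero L] (z : TorusSite 3 L), |torusGreen z| ≤ C₀ := by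
  classical
  obtain ⟨K, hK, hq⟩ := abs_torusHeatKernel_le
  set C₁ : ℝ := ∑' n : ℤ, (1 / 2 : ℝ) ^ n.natAbs with hC₁
  have hC₁0 : 0 ≤ C₁ := tsum_nonneg fun n => by positivity
  refine ⟨4 * Real.sqrt 2 * K ^ 3 + 1 + C₁ ^ 3 / 8, by positivity, ?_⟩
  intro L _ z
  have hL : (0 : ℝ) < L := by exact_mod_cast Nat.pos_of_ne_zero (NeZero.ne L)
  have hL1 : (1 : ℝ) ≤ L := by exact_mod_cast Nat.one_le_iff_ne_zero.mpr (NeZero.ne L)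
  have hS : (0 : ℝ) ≤ (L : ℝ) ^ 2 := by positivity
  have hL3 : (0 : ℝ) < (L : ℝ) ^ 3 := by positivity
  rw [torusGreen_eq_integral_add_tail z ((L : ℝ) ^ 2)]
  -- heat-kernel part
  have hmain : |∫ s in (0 : ℝ)..(L : ℝ) ^ 2, (∏ i, torusHeatKernel s (z i) - ((L : ℝ) ^ 3)⁻¹)| ≤ 4 * Real.sqrt 2 * K ^ 3 + 1 := by
    have hb : ∀ s ∈ Set.Ioc (0 : ℝ) ((L : ℝ) ^ 2),
        |∏ i, torusHeatKernel s (z i) - ((L : ℝ) ^ 3)⁻¹| ≤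
          2 * Real.sqrt 2 * K ^ 3 * ((s + 1) * Real.sqrt (s + 1))⁻¹ + ((L : ℝ) ^ 3)⁻¹ := by
      intro s hs
      set T : ℝ := max 1 s with hT
      have hT1 : 1 ≤ T := le_max_left _ _
      have hTs : s ≤ T := le_max_right _ _
      have hT0 : 0 < T := by positivity
      set σ : ℝ := T ^ (-(1 / 2 : ℝ)) with hσ
      have hσ0 : 0 < σ := Real.rpow_pos_of_pos hT0 _
      have hσσ : σ * σ = T⁻¹ := max_one_rpow_neg_half_mul_self s
      have hs1 : 0 < s + 1 := by linarith [hs.1]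
      -- each factor `≤ K·σ`
      have hfac : ∀ m : ZMod L, |torusHeatKernel s m| ≤ K * σ := fun m => by
        refine (hq L s hs.1 hs.2 m).trans ?_
        have hW1 : ((1 + (m.valMinAbs : ℝ) ^ 2 / max 1 s) ^ 3)⁻¹ ≤ 1 :=
          inv_le_one_of_one_le₀ (one_le_pow₀ (by
            have : 0 ≤ (m.valMinAbs : ℝ) ^ 2 / max 1 s := by positivity
            linarith))
        calc K * (max 1 s) ^ (-(1 / 2 : ℝ)) * ((1 + (m.valMinAbs : ℝ) ^ 2 / max 1 s) ^ 3)⁻¹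
            ≤ K * (max 1 s) ^ (-(1 / 2 : ℝ)) * 1 := by gcongr
          _ = K * σ := by rw [hσ, hT, mul_one]
      have hprod : |∏ i, torusHeatKernel s (z i)| ≤ (K * σ) ^ 3 := by
        rw [Finset.abs_prod]
        calc ∏ i, |torusHeatKernel s (z i)| ≤ ∏ _i : Fin 3, K * σ :=
              Finset.prod_le_prod (fun i _ => abs_nonneg _) fun i _ => hfac (z i)
          _ = (K * σ) ^ 3 := by rw [Finset.prod_const, Finset.card_univ, Fintype.card_fin]
      -- `σ ≤ √2∕√(s+1)` and `T⁻¹ ≤ 2∕(s+1)`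
      have hTinv : T⁻¹ ≤ 2 / (s + 1) := by
        rw [inv_eq_one_div, div_le_div_iff₀ hT0 hs1]
        rw [hT, one_mul]
        rcases le_or_gt s 1 with h1s | h1s
        · rw [max_eq_left h1s]; linarith
        · rw [max_eq_right h1s.le]; linarith
      have hσle : σ ≤ Real.sqrt 2 / Real.sqrt (s + 1) := by
        rw [← Real.sqrt_div (by norm_num : (0 : ℝ) ≤ 2) (s + 1), ← Real.sqrt_sq hσ0.le]
        apply Real.sqrt_le_sqrt
        rw [sq, hσσ]
        exact hTinv
      have hsq1 : 0 < Real.sqrt (s + 1) := Real.sqrt_pos.2 hs1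
      have hσ3 : (K * σ) ^ 3 ≤ 2 * Real.sqrt 2 * K ^ 3 * ((s + 1) * Real.sqrt (s + 1))⁻¹ := by
        have e : (K * σ) ^ 3 = K ^ 3 * (σ * σ) * σ := by ring
        rw [e, hσσ]
        calc K ^ 3 * T⁻¹ * σ ≤ K ^ 3 * (2 / (s + 1)) * (Real.sqrt 2 / Real.sqrt (s + 1)) := by gcongr
          _ = 2 * Real.sqrt 2 * K ^ 3 * ((s + 1) * Real.sqrt (s + 1))⁻¹ := by field_simp
      calc |∏ i, torusHeatKernel s (z i) - ((L : ℝ) ^ 3)⁻¹|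
          ≤ |∏ i, torusHeatKernel s (z i)| + |((L : ℝ) ^ 3)⁻¹| := abs_sub _ _
        _ ≤ 2 * Real.sqrt 2 * K ^ 3 * ((s + 1) * Real.sqrt (s + 1))⁻¹ + ((L : ℝ) ^ 3)⁻¹ := by
            rw [abs_of_pos (inv_pos.2 hL3)]
            exact add_le_add (hprod.trans hσ3) le_rfl
    have hcont : IntervalIntegrable (fun s : ℝ => 2 * Real.sqrt 2 * K ^ 3 * ((s + 1) * Real.sqrt (s + 1))⁻¹ + ((L : ℝ) ^ 3)⁻¹)
        volume 0 ((L : ℝ) ^ 2) := by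
      refine (ContinuousOn.intervalIntegrable ?_).add (by simp)
      rw [Set.uIcc_of_le hS]
      refine continuousOn_const.mul (ContinuousOn.inv₀ ((continuousOn_id.add continuousOn_const).mul
        ((continuousOn_id.add continuousOn_const).sqrt)) fun s hs => ?_)
      have hsc : 0 < s + 1 := by linarith [hs.1]
      exact mul_ne_zero hsc.ne' (Real.sqrt_ne_zero'.2 hsc)
    have hI1 : IntervalIntegrable (fun s : ℝ => 2 * Real.sqrt 2 * K ^ 3 * ((s + 1) * Real.sqrt (s + 1))⁻¹) volume 0 ((L : ℝ) ^ 2) := by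
      refine ContinuousOn.intervalIntegrable ?_
      rw [Set.uIcc_of_le hS]
      refine continuousOn_const.mul (ContinuousOn.inv₀ ((continuousOn_id.add continuousOn_const).mul
        ((continuousOn_id.add continuousOn_const).sqrt)) fun s hs => ?_)
      have hsc : 0 < s + 1 := by linarith [hs.1]
      exact mul_ne_zero hsc.ne' (Real.sqrt_ne_zero'.2 hsc)
    calc _ ≤ ∫ s in (0 : ℝ)..(L : ℝ) ^ 2, (2 * Real.sqrt 2 * K ^ 3 * ((s + 1) * Real.sqrt (s + 1))⁻¹ + ((L : ℝ) ^ 3)⁻¹) := by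
          have h := intervalIntegral.norm_integral_le_of_norm_le hS
            (Filter.Eventually.of_forall fun s hs => (Real.norm_eq_abs _).le.trans (hb s hs)) hcont
          rwa [Real.norm_eq_abs] at h
      _ = 2 * Real.sqrt 2 * K ^ 3 * (∫ s in (0 : ℝ)..(L : ℝ) ^ 2, ((s + 1) * Real.sqrt (s + 1))⁻¹) + ((L : ℝ) ^ 2 - 0) * ((L : ℝ) ^ 3)⁻¹ := by
          rw [intervalIntegral.integral_add hI1 (by simp), intervalIntegral.integral_const_mul, intervalIntegral.integral_const, smul_eq_mul]
      _ ≤ 2 * Real.sqrt 2 * K ^ 3 * (2 / Real.sqrt 1) + 1 := by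
          have h1 : ((L : ℝ) ^ 2 - 0) * ((L : ℝ) ^ 3)⁻¹ ≤ 1 := by
            rw [sub_zero, show ((L : ℝ) ^ 2) * ((L : ℝ) ^ 3)⁻¹ = (L : ℝ)⁻¹ by field_simp]
            exact inv_le_one_of_one_le₀ hL1
          have h2 := integral_inv_mul_sqrt_le (c := 1) one_pos hS
          gcongr
      _ = 4 * Real.sqrt 2 * K ^ 3 + 1 := by rw [Real.sqrt_one]; ring
  -- Fourier tail
  have htail : |(∑ k ∈ (univ : Finset (TorusSite 3 L)).erase 0,
        Real.cos (∑ i, latticeMomentum L k i * ((z i).val : ℝ)) *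
          (Real.exp (-((L : ℝ) ^ 2 * dispersion (latticeMomentum L k))) / dispersion (latticeMomentum L k))) / (L : ℝ) ^ 3| ≤ C₁ ^ 3 / 8 := by
    rw [abs_div, abs_of_pos hL3, div_le_iff₀ hL3]
    have hterm : ∀ k ∈ (univ : Finset (TorusSite 3 L)).erase 0,
        |Real.cos (∑ i, latticeMomentum L k i * ((z i).val : ℝ)) *
          (Real.exp (-((L : ℝ) ^ 2 * dispersion (latticeMomentum L k))) / dispersion (latticeMomentum L k))| ≤
          (L : ℝ) ^ 2 / 8 * ∏ μ, (1 / 2 : ℝ) ^ (k μ).valMinAbs.natAbs := by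
      intro k hk
      have hk0 : k ≠ 0 := Finset.ne_of_mem_erase hk
      have hε := dispersion_latticeMomentum_pos hk0
      have hgap : (dispersion (latticeMomentum L k))⁻¹ ≤ (L : ℝ) ^ 2 / 8 := by
        have h8 := eight_div_sq_le_dispersion k hk0
        calc (dispersion (latticeMomentum L k))⁻¹ ≤ (8 / (L : ℝ) ^ 2)⁻¹ := inv_anti₀ (by positivity) h8
          _ = (L : ℝ) ^ 2 / 8 := by rw [inv_div]
      have hexp : Real.exp (-((L : ℝ) ^ 2 * dispersion (latticeMomentum L k))) ≤ ∏ μ, (1 / 2 : ℝ) ^ (k μ).valMinAbs.natAbs :=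
        (exp_neg_sq_mul_dispersion_le k).trans (Finset.prod_le_prod (fun μ _ => (Real.exp_pos _).le)
          fun μ _ => exp_neg_eight_mul_sq_le _)
      rw [abs_mul, abs_div, Real.abs_exp, abs_of_pos hε]
      calc |Real.cos (∑ i, latticeMomentum L k i * ((z i).val : ℝ))| *
            (Real.exp (-((L : ℝ) ^ 2 * dispersion (latticeMomentum L k))) / dispersion (latticeMomentum L k))
          ≤ 1 * (Real.exp (-((L : ℝ) ^ 2 * dispersion (latticeMomentum L k))) / dispersion (latticeMomentum L k)) :=
            mul_le_mul_of_nonneg_right (Real.abs_cos_le_one _) (by positivity)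
        _ = Real.exp (-((L : ℝ) ^ 2 * dispersion (latticeMomentum L k))) * (dispersion (latticeMomentum L k))⁻¹ := by
            rw [one_mul, div_eq_mul_inv]
        _ ≤ (∏ μ, (1 / 2 : ℝ) ^ (k μ).valMinAbs.natAbs) * ((L : ℝ) ^ 2 / 8) :=
            mul_le_mul hexp hgap (by positivity) (Finset.prod_nonneg fun μ _ => by positivity)
        _ = (L : ℝ) ^ 2 / 8 * ∏ μ, (1 / 2 : ℝ) ^ (k μ).valMinAbs.natAbs := by ring
    calc |∑ k ∈ (univ : Finset (TorusSite 3 L)).erase 0,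
          Real.cos (∑ i, latticeMomentum L k i * ((z i).val : ℝ)) *
            (Real.exp (-((L : ℝ) ^ 2 * dispersion (latticeMomentum L k))) / dispersion (latticeMomentum L k))|
        ≤ ∑ k ∈ (univ : Finset (TorusSite 3 L)).erase 0, (L : ℝ) ^ 2 / 8 * ∏ μ, (1 / 2 : ℝ) ^ (k μ).valMinAbs.natAbs :=
          (Finset.abs_sum_le_sum_abs _ _).trans (Finset.sum_le_sum hterm)
      _ ≤ ∑ k : TorusSite 3 L, (L : ℝ) ^ 2 / 8 * ∏ μ, (1 / 2 : ℝ) ^ (k μ).valMinAbs.natAbs :=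
          Finset.sum_le_sum_of_subset_of_nonneg (Finset.erase_subset _ _) fun _ _ _ => by positivity
      _ = (L : ℝ) ^ 2 / 8 * (∑ κ : ZMod L, (1 / 2 : ℝ) ^ κ.valMinAbs.natAbs) ^ 3 := by
          rw [← Finset.mul_sum]
          congr 1
          rw [show (∑ κ : ZMod L, (1 / 2 : ℝ) ^ κ.valMinAbs.natAbs) ^ 3 =
              ∏ _μ : Fin 3, ∑ κ : ZMod L, (1 / 2 : ℝ) ^ κ.valMinAbs.natAbs by
            rw [Finset.prod_const, Finset.card_univ, Fintype.card_fin],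
            Finset.prod_univ_sum]
          simp only [Fintype.piFinset_univ]
      _ ≤ (L : ℝ) ^ 2 / 8 * C₁ ^ 3 := by
          gcongr
          exact sum_half_pow_valMinAbs_le
      _ ≤ C₁ ^ 3 / 8 * (L : ℝ) ^ 3 := by
          rw [show C₁ ^ 3 / 8 * (L : ℝ) ^ 3 = (L : ℝ) ^ 3 / 8 * C₁ ^ 3 by ring]
          gcongr
          nlinarith
  exact (abs_add_le _ _).trans (add_le_add hmain htail)

/-! ## §3 The window on a sup-shell, size version -/

/-- **The shell hypothesis for the windowed SIZE**: with `C` the constant of the pointwise size row `|G̃_L(z)|·√(Σz̃²) ≤ C` (`z ≠ 0`), for `1 ≤ r`, `2r < L` and `y` on the sup-shell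
`Q_r(0) ∖ Q_{r−1}(0) ⊂ ℤ³`: `πy` has `z̃ = y` (no wrap), `πy ≠ 0`, `Σz̃² ≥ r²`, hence `|G̃_L(πy)| ≤ C∕r = C∕r^{3−2}`. [folklore] -/
theorem abs_torusGreen_window_le_of_mem_shell [NeZero L] {C : ℝ}
    (hC : ∀ (z : TorusSite 3 L), z ≠ 0 → |torusGreen z| * Real.sqrt (∑ k, (((z k).valMinAbs : ℤ) : ℝ) ^ 2) ≤ C)
    {r : ℤ} (hr : 1 ≤ r) (hrL : 2 * r < L) {y : Zd 3} (hy : y ∈ (box 0 r) \ (box 0 (r - 1))) :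
    |torusGreen (fun μ => ((y μ : ℤ) : ZMod L))| ≤ C / (r : ℝ) ^ (3 - 2) := by
  set z : TorusSite 3 L := fun μ => ((y μ : ℤ) : ZMod L) with hz
  have hin : ∀ μ, |y μ| ≤ r := fun μ => by
    have := (Finset.mem_sdiff.1 hy).1
    rw [B4Eq19LatticeOperators.mem_box] at this
    simpa using this μ
  have hval : ∀ μ, (z μ).valMinAbs = y μ := fun μ =>
    valMinAbs_intCast_of_two_mul_abs_lt (by have := hin μ; linarith)
  have hsq : ((r : ℝ)) ^ 2 ≤ ∑ k, (((z k).valMinAbs : ℤ) : ℝ) ^ 2 := by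
    simp_rw [hval]
    exact sq_le_sum_sq_of_mem_shell hy
  have hr0 : (0 : ℝ) < r := by exact_mod_cast (show (0 : ℤ) < r by linarith)
  have hz0 : z ≠ 0 := by
    intro h
    have : ∑ k, (((z k).valMinAbs : ℤ) : ℝ) ^ 2 = 0 := by simp [h]
    nlinarith
  have hsqrt : (r : ℝ) ≤ Real.sqrt (∑ k, (((z k).valMinAbs : ℤ) : ℝ) ^ 2) := by
    rw [← Real.sqrt_sq hr0.le]
    exact Real.sqrt_le_sqrt hsq
  have h := hC z hz0
  rw [show (3 - 2 : ℕ) = 1 by norm_num, pow_one, le_div_iff₀ hr0]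
  calc |torusGreen z| * (r : ℝ) ≤ |torusGreen z| * Real.sqrt (∑ k, (((z k).valMinAbs : ℤ) : ℝ) ^ 2) :=
        mul_le_mul_of_nonneg_left hsqrt (abs_nonneg _)
    _ ≤ C := h

/-! ## §4 ★★★ The near-field ball sum of the size -/

/-- ★★ **Box form**: with `C₀` of ✓ `abs_torusGreen_le` and the pointwise size constant `C ≥ 0` of `hC`: for `2R < L`,
`Σ_{y ∈ Q_R(0) ⊂ ℤ³} |G̃_L(πy)| ≤ C₀ + 54·C·R²` (✓ `sum_box_le_of_shell_decay_two`). [folklore] -/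
theorem sum_box_abs_torusGreen_le_of_size : ∃ C₀ : ℝ, 0 ≤ C₀ ∧ ∀ (L : ℕ) [NeZero L] (C : ℝ), 0 ≤ C →
    (∀ (z : TorusSite 3 L), z ≠ 0 → |torusGreen z| * Real.sqrt (∑ k, (((z k).valMinAbs : ℤ) : ℝ) ^ 2) ≤ C) →
    ∀ (R : ℕ), 2 * (R : ℤ) < L →
      ∑ y ∈ box (0 : Zd 3) R, |torusGreen (L := L) (fun μ => ((y μ : ℤ) : ZMod L))| ≤ C₀ + 2 * (3 : ℕ) * 3 ^ (3 - 1) * C * (R : ℝ) ^ 2 := by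
  obtain ⟨C₀, hC₀, h₀⟩ := abs_torusGreen_le
  refine ⟨C₀, hC₀, ?_⟩
  intro L _ C hC0 hC R hRL
  set k : Zd 3 → ℝ := fun y => |torusGreen (L := L) (fun μ => ((y μ : ℤ) : ZMod L))| with hk
  have hkabs : ∀ y, |k y| = k y := fun y => abs_of_nonneg (abs_nonneg _)
  have hshell : ∀ r : ℤ, 1 ≤ r → r ≤ R → ∀ y ∈ (box (0 : Zd 3) r) \ (box 0 (r - 1)), |k y| ≤ C / (r : ℝ) ^ (3 - 2) := by
    intro r hr hrR y hy
    rw [hkabs]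
    exact abs_torusGreen_window_le_of_mem_shell hC hr (by linarith) hy
  have h := sum_box_le_of_shell_decay_two (d := 3) (by norm_num) (0 : Zd 3) k hC0 R hshell
  simp_rw [hkabs] at h
  have hk0 : k 0 ≤ C₀ := by
    rw [hk]
    simpa using h₀ L (fun _ => ((0 : ℤ) : ZMod L))
  calc ∑ y ∈ box (0 : Zd 3) R, k y ≤ k 0 + 2 * (3 : ℕ) * 3 ^ (3 - 1) * C * (R : ℝ) ^ 2 := h
    _ ≤ C₀ + 2 * (3 : ℕ) * 3 ^ (3 - 1) * C * (R : ℝ) ^ 2 := by gcongr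

/-- ★★★ **THE NEAR-FIELD BALL SUM OF THE SIZE** (row (G₁-SIZE-BALL)): there is an absolute `C₀ ≥ 0` such that for every `L ≥ 1`, every pointwise size constant `C ≥ 0` with
`|G̃_L(z)|·√(Σz̃²) ≤ C` (`z ≠ 0`; px4's (G₁-SIZE-3) row, displayed) and every radius `R` with `2R < L`:
`Σ_{z ∈ (ℤ/Lℤ)³ : ∀μ |z̃_μ| ≤ R} |G̃_L(z)| ≤ C₀ + 54·C·R²`  — the `Σ_{r≤R} r²·r⁻¹ ≍ R²` count behind (hK₀)'s near field and (hK₂)'s `Σ_{r≲ℓ}|G₁|` (★routeR-w3 g5 (E1) LOCATE §3).  Proof: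
the torus sum is a sub-sum of the box form under `cen z := (z̃_μ)_μ` (px7's ✓p662443 device). [folklore] -/
theorem sum_ball_abs_torusGreen_le_of_size : ∃ C₀ : ℝ, 0 ≤ C₀ ∧ ∀ (L : ℕ) [NeZero L] (C : ℝ), 0 ≤ C →
    (∀ (z : TorusSite 3 L), z ≠ 0 → |torusGreen z| * Real.sqrt (∑ k, (((z k).valMinAbs : ℤ) : ℝ) ^ 2) ≤ C) →
    ∀ (R : ℕ), 2 * (R : ℤ) < L →
      ∑ z ∈ (Finset.univ : Finset (TorusSite 3 L)).filter (fun z => ∀ μ, (z μ).valMinAbs.natAbs ≤ R),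
        |torusGreen z| ≤ C₀ + 54 * C * (R : ℝ) ^ 2 := by
  classical
  obtain ⟨C₀, hC₀, h⟩ := sum_box_abs_torusGreen_le_of_size
  refine ⟨C₀, hC₀, ?_⟩
  intro L _ C hC0 hC R hRL
  set B : Finset (TorusSite 3 L) := Finset.univ.filter (fun z => ∀ μ, (z μ).valMinAbs.natAbs ≤ R) with hB
  set g : TorusSite 3 L → ℝ := fun z => |torusGreen z| with hg
  set wnd : Zd 3 → TorusSite 3 L := fun y μ => ((y μ : ℤ) : ZMod L) with hwnd
  set cen : TorusSite 3 L → Zd 3 := fun z μ => (z μ).valMinAbs with hcen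
  have hwc : ∀ z, wnd (cen z) = z := fun z => by
    funext μ
    simp [hwnd, hcen, ZMod.coe_valMinAbs]
  have hcen_inj : Function.Injective cen := fun z z' hzz => by
    rw [← hwc z, ← hwc z', hzz]
  have hcenB : B.image cen ⊆ box (0 : Zd 3) R := by
    intro y hy
    obtain ⟨z, hz, rfl⟩ := Finset.mem_image.1 hy
    rw [hB, Finset.mem_filter] at hz
    rw [B4Eq19LatticeOperators.mem_box]
    intro μ
    have := hz.2 μ
    simp only [hcen, Pi.zero_apply, sub_zero]
    rw [← Int.natCast_natAbs]
    exact_mod_cast this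
  have e1 : ∑ z ∈ B, g z = ∑ y ∈ B.image cen, g (wnd y) := by
    rw [Finset.sum_image fun z _ z' _ hzz => hcen_inj hzz]
    exact Finset.sum_congr rfl fun z _ => by rw [hwc]
  have e2 : ∑ y ∈ B.image cen, g (wnd y) ≤ ∑ y ∈ box (0 : Zd 3) R, g (wnd y) :=
    Finset.sum_le_sum_of_subset_of_nonneg hcenB fun y _ _ => abs_nonneg _
  have e3 := h L C hC0 hC R hRL
  calc ∑ z ∈ B, g z ≤ ∑ y ∈ box (0 : Zd 3) R, g (wnd y) := e1.le.trans e2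
    _ ≤ C₀ + 2 * (3 : ℕ) * 3 ^ (3 - 1) * C * (R : ℝ) ^ 2 := e3
    _ = C₀ + 54 * C * (R : ℝ) ^ 2 := by norm_num

/-! ## §5 ★★★ The unconditional ball sums (`hC` discharged by px4's size row) and the B5 reading -/

/-- ★★★ **THE NEAR-FIELD BALL SUM OF THE SIZE, UNCONDITIONAL**: there is an absolute `C ≥ 0` such that for every `L ≥ 1` and every radius `R` with `2R < L`,
`Σ_{z ∈ (ℤ/Lℤ)³ : ∀μ |z̃_μ| ≤ R} |G̃_L(z)| ≤ C·(R + 1)²` — ✓ `sum_ball_abs_torusGreen_le_of_size` with `hC :=` px4's ✓ `torusGreen_mul_dist_le`. [folklore] -/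
theorem sum_ball_abs_torusGreen_le : ∃ C : ℝ, 0 ≤ C ∧ ∀ (L : ℕ) [NeZero L] (R : ℕ), 2 * (R : ℤ) < L →
    ∑ z ∈ (Finset.univ : Finset (TorusSite 3 L)).filter (fun z => ∀ μ, (z μ).valMinAbs.natAbs ≤ R),
      |torusGreen z| ≤ C * ((R : ℝ) + 1) ^ 2 := by
  obtain ⟨C₀, hC₀, h⟩ := sum_ball_abs_torusGreen_le_of_size
  obtain ⟨CS, hS⟩ := torusGreen_mul_dist_le
  have hS' : ∀ (L : ℕ) [NeZero L] (z : TorusSite 3 L), z ≠ 0 →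
      |torusGreen z| * Real.sqrt (∑ k, (((z k).valMinAbs : ℤ) : ℝ) ^ 2) ≤ max CS 0 :=
    fun L _ z hz => (hS L z hz).trans (le_max_left _ _)
  refine ⟨C₀ + 54 * max CS 0, by positivity, ?_⟩
  intro L _ R hRL
  have hR : (0 : ℝ) ≤ R := Nat.cast_nonneg R
  have hm : (0 : ℝ) ≤ max CS 0 := le_max_right _ _
  calc _ ≤ C₀ + 54 * max CS 0 * (R : ℝ) ^ 2 := h L (max CS 0) hm (hS' L) R hRL
    _ ≤ (C₀ + 54 * max CS 0) * ((R : ℝ) + 1) ^ 2 := by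
        have h1 : C₀ ≤ C₀ * ((R : ℝ) + 1) ^ 2 := le_mul_of_one_le_right hC₀ (by nlinarith)
        have h2 : 54 * max CS 0 * (R : ℝ) ^ 2 ≤ 54 * max CS 0 * ((R : ℝ) + 1) ^ 2 := by gcongr; linarith
        linarith [h1, h2]

/-- ★★ **The ball sum in B5's `Δ⁻¹` letters, centred** (unconditional): there is an absolute `C ≥ 0` such that for every `L ≥ 1`, centre `b` and radius `R` with `2R < L`,
`Σ_{z : ∀μ |(b − z)~_μ| ≤ R} ‖LapSinv (fun _ => L) 1 b z‖ ≤ C·(R + 1)²` — by ✓ `LapSinv_one_apply_eq_half_torusGreen` (`Δ⁻¹(b,z) = ½G̃_L(b − z)`) and the reindexing `z ↦ b − z`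
onto ✓ `sum_ball_abs_torusGreen_le` (px7's ✓ `sum_ball_norm_LapSinv_grad_le` script). [folklore] -/
theorem sum_ball_norm_LapSinv_le : ∃ C : ℝ, 0 ≤ C ∧ ∀ (L : ℕ) [NeZero L] (b : TorusSite 3 L) (R : ℕ), 2 * (R : ℤ) < L →
    ∑ z ∈ (Finset.univ : Finset (TorusSite 3 L)).filter (fun z => ∀ μ, ((b - z) μ).valMinAbs.natAbs ≤ R),
      ‖LapSinv (fun _ : Fin 3 => L) (1 : ℂ) b z‖ ≤ C * ((R : ℝ) + 1) ^ 2 := by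
  classical
  obtain ⟨C, hC, h⟩ := sum_ball_abs_torusGreen_le
  refine ⟨C / 2, by positivity, ?_⟩
  intro L _ b R hRL
  have hterm : ∀ z : TorusSite 3 L,
      ‖LapSinv (fun _ : Fin 3 => L) (1 : ℂ) b z‖ = |torusGreen (b - z)| / 2 := by
    intro z
    rw [LapSinv_one_apply_eq_half_torusGreen, Complex.norm_real, Real.norm_eq_abs, abs_div, abs_two]
  simp_rw [hterm]
  rw [← Finset.sum_div, div_le_iff₀ (by norm_num : (0 : ℝ) < 2)]
  have e : ∑ z ∈ (Finset.univ : Finset (TorusSite 3 L)).filter (fun z => ∀ μ, ((b - z) μ).valMinAbs.natAbs ≤ R), |torusGreen (b - z)|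
      = ∑ u ∈ (Finset.univ : Finset (TorusSite 3 L)).filter (fun u => ∀ μ, (u μ).valMinAbs.natAbs ≤ R), |torusGreen u| := by
    rw [Finset.sum_filter, Finset.sum_filter]
    exact Fintype.sum_equiv (Equiv.subLeft b) _ _ fun z => by simp [Equiv.subLeft]
  rw [e]
  calc _ ≤ C * ((R : ℝ) + 1) ^ 2 := h L R hRL
    _ = C / 2 * ((R : ℝ) + 1) ^ 2 * 2 := by ring

end Summit.QuantumFields.YangMills.Theorems.Prop7NearFieldGreenSizeSum
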